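import Mathlib
import HarnessLib
import Literature.Probability.MarkovChains.MetropolisHastings
import Summits.Ventures.LatticeQCDFlow.Exactness.NoisyAcceptBias

/-!
# LatticeQCDFlow / Exactness — per-step exactness does not survive STATE-DEPENDENT (online)
# adaptation: two exact Metropolis kernels for the same target, chosen by the current state,
# sample the wrong law; a state-independent schedule stays exact

HONEST FRAMING: exact (Metropolis-corrected) sampling algorithms for lattice gauge theory;
figures of merit are autocorrelation/cost numbers at stated couplings and volumes; no
continuum-physics claim.

Venture `LatticeQCDFlow` (cell pub-lqcd), topic `Exactness`; landed by FANOUT row 38 (r2-scope,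
gen 3) as the Lean face of requirement E10 of HOME/R2-SCOPE.md v1.0.6 ("parameters of the
proposal / effective action / flow are FROZEN on the scored segment, or change on a schedule that
does not read the chain").  NEW WORK of the cell (elementary finite arithmetic), not a published
result; printed counterparts named in docstrings: the ergodic theory of adaptive MCMC (Roberts–
Rosenthal, J. Appl. Probab. 44 (2007) 458: Diminishing Adaptation + Containment), carried to
adaptive independence samplers with normalizing-flow proposals by Brofos–Gabrié–Brubaker–Lederman
(AISTATS 2022, arXiv:2110.13216 §4: a DETERMINISTIC parameter sequence keeps `Π` stationary at
every step; state-dependent adaptation needs the two conditions, and "among the works above,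
ergodicity was only tested numerically"); the lattice instance is self-learning (H)MC with network
parameters "updated … each Monte Carlo step" (Nagai–Ohno–Tomiya, PoS LATTICE2024 030 =
arXiv:2501.16955 §4) versus weights "fix[ed] during the production run" (Nagai–Tomiya,
arXiv:2103.11965 §3.1.2).

Setting.  A family of Markov kernels `K θ` on a finite `X`, EVERY member exact for the same target
`π` (`IsStationary π (K θ)`), and a selection rule.  Two regimes:
* SCHEDULED (state-independent): the kernel used at step `n` is `K (θ n)` for a sequence fixed in
  advance (or drawn independently of the chain).  Each step preserves `π`, so does any composition
  — in the tree as `isStationary_comp` / `compKernel` of `Exactness/LocalUpdates.lean` (not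
  re-proved here); the constant-selection case is `adaptKernel_isStationary_of_const`.
* ONLINE (state-dependent): the kernel used from state `x` is `K (σ x)` — the index is read off
  the current configuration (the simplest caricature of "train on the sample just produced, then
  propose with the updated parameters").  The `X`-process is again Markov, with kernel
  `adaptKernel K σ x y = K (σ x) x y`, but `π` need not be stationary for it.

THE WITNESS (`Fin 2`, target `π₂ = (1/3, 2/3)` from `NoisyAcceptBias.lean`): `K 0` = Metropolis–
Hastings with the uniform proposal `T₂`, `K 1` = Metropolis–Hastings with the "always propose the
other state" proposal `Tflip₂`; both are exact (`K₂_isStationary`).  Selecting `K x` at state `x`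
gives off-diagonal entries `1/2, 1/2` (`adaptKernel₂_entries`), so the online chain samples the
UNIFORM law (`adapt₂_stationary_uniform`) and not `π₂` (`adapt₂_not_stationary`): a relative bias
of `1/2` on state `0` (`adapt₂_relative_bias`) from two individually exact kernels.

Use: an R2 (or R1) row whose proposal model / effective action is updated during the scored
segment is not exact by the per-step argument; the cell scores FROZEN-parameter segments
(header field `adaptation`, R2-SCOPE.md §3 E10 / §5.3).
-/

namespace Summit.Ventures.LatticeQCDFlow.Exactness

open Finset
open Literature.Probability.MarkovChains

/-! ## Scheduled versus online selection among exact kernels -/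

section General

variable {X Θ : Type*} [Fintype X]

/-- ONLINE selection: from state `x` use the kernel indexed by `σ x` (the index is read off the
current configuration). [folklore] -/
def adaptKernel (K : Θ → X → X → ℝ) (σ : X → Θ) (x y : X) : ℝ := K (σ x) x y

/-- The online-selected kernel is still row-stochastic when every member is. [folklore] -/
theorem adaptKernel_sum_eq_one {K : Θ → X → X → ℝ} (hK : ∀ θ x, ∑ y, K θ x y = 1) (σ : X → Θ)
    (x : X) : ∑ y, adaptKernel K σ x y = 1 := hK (σ x) x

/-- A STATE-INDEPENDENT selection (constant `σ`) inherits exactness from the selected member.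
[folklore] -/
theorem adaptKernel_isStationary_of_const {π : X → ℝ} {K : Θ → X → X → ℝ} (θ₀ : Θ)
    (h : IsStationary π (K θ₀)) : IsStationary π (adaptKernel K (fun _ => θ₀)) := h

end General

/-! ## The witness: two exact Metropolis kernels for `π₂ = (1/3, 2/3)`, selected by the state -/

section Witness

/-- "Always propose the other state" on `Fin 2`. [folklore] -/
noncomputable def Tflip₂ : Fin 2 → Fin 2 → ℝ := fun x y => if y = x then 0 else 1

/-- Flip proposal entry `0 → 1`. [folklore] -/
@[simp] theorem Tflip₂_zero_one : Tflip₂ 0 1 = 1 := by simp [Tflip₂]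

/-- Flip proposal entry `1 → 0`. [folklore] -/
@[simp] theorem Tflip₂_one_zero : Tflip₂ 1 0 = 1 := by simp [Tflip₂]

/-- The two-member family: index `0` = Metropolis–Hastings with the uniform proposal `T₂`,
index `1` = Metropolis–Hastings with the flip proposal `Tflip₂`; same target `π₂`. [folklore] -/
noncomputable def K₂ : Fin 2 → Fin 2 → Fin 2 → ℝ :=
  ![mhKernel T₂ π₂, mhKernel Tflip₂ π₂]

/-- Member `0` of the family. [folklore] -/
@[simp] theorem K₂_zero : K₂ 0 = mhKernel T₂ π₂ := rfl

/-- Member `1` of the family. [folklore] -/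
@[simp] theorem K₂_one : K₂ 1 = mhKernel Tflip₂ π₂ := rfl

/-- Positivity of the target (from `NoisyAcceptBias.lean`'s `π₂ = (1/3, 2/3)`). [folklore] -/
theorem π₂_pos' (x : Fin 2) : 0 < π₂ x := by fin_cases x <;> simp

/-- **Every member of the family is exact** for `π₂` (tree theorem `mhKernel_isStationary`, any
proposal matrix). [folklore] -/
theorem K₂_isStationary (θ : Fin 2) : IsStationary π₂ (K₂ θ) := by
  fin_cases θ
  · exact mhKernel_isStationary π₂_pos' T₂
  · exact mhKernel_isStationary π₂_pos' Tflip₂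

/-- Member `0`, rate `0 → 1`: `min {1/2, (2/3)(1/2)/(1/3)} = 1/2`. [folklore] -/
theorem mhRate_T₂_zero_one : mhRate T₂ π₂ 0 1 = 1 / 2 := by
  simp only [mhRate, T₂_apply, π₂_zero, π₂_one]
  norm_num [min_def]

/-- Member `1`, rate `1 → 0`: `min {1, (1/3)(1)/(2/3)} = 1/2`. [folklore] -/
theorem mhRate_Tflip₂_one_zero : mhRate Tflip₂ π₂ 1 0 = 1 / 2 := by
  simp only [mhRate, Tflip₂_zero_one, Tflip₂_one_zero, π₂_zero, π₂_one]
  norm_num [min_def]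

/-- `univ.erase 0 = {1}` in `Fin 2` (private helper). [folklore] -/
private theorem erase_zero₂'' : (univ : Finset (Fin 2)).erase 0 = {1} := by decide

/-- `univ.erase 1 = {0}` in `Fin 2` (private helper). [folklore] -/
private theorem erase_one₂'' : (univ : Finset (Fin 2)).erase 1 = {0} := by decide

/-- The ONLINE chain of the witness: at state `x` use member `x`. [folklore] -/
noncomputable def adapt₂ : Fin 2 → Fin 2 → ℝ := adaptKernel K₂ id

/-- Its four entries: all equal to `1/2`. [folklore] -/
theorem adaptKernel₂_entries :
    adapt₂ 0 1 = 1 / 2 ∧ adapt₂ 1 0 = 1 / 2 ∧ adapt₂ 0 0 = 1 / 2 ∧ adapt₂ 1 1 = 1 / 2 := by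
  refine ⟨?_, ?_, ?_, ?_⟩
  · show mhKernel T₂ π₂ 0 1 = 1 / 2
    rw [mhKernel_of_ne (by decide), mhRate_T₂_zero_one]
  · show mhKernel Tflip₂ π₂ 1 0 = 1 / 2
    rw [mhKernel_of_ne (by decide), mhRate_Tflip₂_one_zero]
  · show mhKernel T₂ π₂ 0 0 = 1 / 2
    rw [mhKernel_self, erase_zero₂'', sum_singleton, mhRate_T₂_zero_one]; norm_num
  · show mhKernel Tflip₂ π₂ 1 1 = 1 / 2
    rw [mhKernel_self, erase_one₂'', sum_singleton, mhRate_Tflip₂_one_zero]; norm_num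

/-- **Online adaptation among exact kernels is NOT exact**: `π₂ = (1/3, 2/3)` is not stationary
for the state-selected chain (flow into state `0`: `(1/3)(1/2) + (2/3)(1/2) = 1/2 ≠ 1/3`), although
each member leaves `π₂` invariant (`K₂_isStationary`).  Printed counterpart: ergodicity of
state-dependent adaptation requires Diminishing Adaptation + Containment (Roberts–Rosenthal 2007;
Brofos et al. 2022 §4.2) — an asymptotic statement, not finite-segment invariance. [folklore] -/
theorem adapt₂_not_stationary : ¬ IsStationary π₂ adapt₂ := by
  intro h
  have h0 := h 0
  obtain ⟨-, h10, h00, -⟩ := adaptKernel₂_entries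
  rw [Fin.sum_univ_two, h00, h10, π₂_zero, π₂_one] at h0
  norm_num at h0

/-- The law the online chain DOES sample: uniform. [folklore] -/
theorem adapt₂_stationary_uniform : IsStationary ![(1 : ℝ) / 2, 1 / 2] adapt₂ := by
  obtain ⟨h01, h10, h00, h11⟩ := adaptKernel₂_entries
  intro y
  fin_cases y
  · simp only [Fin.sum_univ_two, Fin.zero_eta, Matrix.cons_val_zero, Matrix.cons_val_one, h00, h10]
    norm_num
  · simp only [Fin.sum_univ_two, Fin.mk_one, Matrix.cons_val_zero, Matrix.cons_val_one, h01, h11]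
    norm_num

/-- Size of the defect: weight of state `0` is `1/2` instead of `1/3`, a relative bias of `1/2`.
[folklore] -/
theorem adapt₂_relative_bias : ((1 : ℝ) / 2 - 1 / 3) / (1 / 3) = 1 / 2 := by norm_num

end Witness

end Summit.Ventures.LatticeQCDFlow.Exactness
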